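import Mathlib
import Summits.NavierStokesRegularity.NavierStokesRegularity.Theorems.EulerZoomLiouvillePowerGaugeEulerLiouvilleSelfSimilarSublinearLoc
import HarnessLib.Audit

/-!
# Rung C1 of the crux `EulerZoomLiouville.PowerGaugeEulerLiouville` (sub-stratum W3b): A UNIFORMLY CONTINUOUS PROFILE IN THE
# GAUGED CLASS HAS SUBLINEAR GROWTH — the classical stratum contains «V ∈ C² ∩ UC», in particular «V ∈ C² ∩ Ẇ^{1,∞}»,
# with `V` UNBOUNDED allowed

Route №10 `EulerZoomLiouville` (NavierStokesRegularity), crux E = stmt-NavierStokesRegularity-19832, tenure rung C1,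
registered residue `stub_selfSimilarExtremalRest`, sub-stratum W3b («`C²` profiles UNBOUNDED at infinity»).  Lineage
ns-typeII-p1 (gen 8).  Companion of `…SelfSimilarSublinearLoc` (`Loc.selfSimilar_ae_eq_zero_of_sublinearC2_profile`: an exactly
self-similar member whose velocity profile is `C²` with `V(y) = o(|y|)` vanishes).

The spike estimate.  The `A`-gauge of an exactly self-similar member forces `∫_{B_L}‖V‖² ≤ c L^{1−2ρ}` for all `L > 0`
(`profile_energy_growth_of_gaugeA`), an exponent `θ = 1 − 2ρ < 2`.  If `V` is UNIFORMLY CONTINUOUS (modulus: `‖V z − V y‖ < 1`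
for `‖z − y‖ < r₀`), a value `‖V(y₀)‖ = h ≥ 2` persists as `‖V‖ ≥ h/2` on `ball y₀ r₀`, so
`(h/2)² r₀³ |B₁| ≤ ∫_{B(0, 2‖y₀‖)}‖V‖² ≤ c (2‖y₀‖)^θ`, i.e. `h ≲ ‖y₀‖^{θ/2}` with `θ/2 < 1`: the profile grows sublinearly, and
the sublinear rigidity theorem applies.  (Lipschitz / Hölder / bounded-gradient profiles are uniformly continuous.)

* `sublinear_of_uniformContinuous_of_growth` — `V` uniformly continuous, `∫⁻_{B_L}‖V‖ₑ² ≤ C L^θ` for all `L > 0` with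
  `C < ∞`, `θ < 2` ⇒ `∀ δ > 0, ∃ R, ∀ y, R ≤ ‖y‖ → ‖V y‖ ≤ δ‖y‖`;
* **`selfSimilar_ae_eq_zero_of_uniformContinuousC2_profile`** — MEMBER LEVEL, crux hypotheses verbatim (`0 < ρ ≤ ½`,
  the window) + exact self-similarity: if the velocity profile is `C²` and UNIFORMLY CONTINUOUS, the member vanishes;
* **`selfSimilar_ae_eq_zero_of_boundedGradientC2_profile`** — in particular if `V ∈ C²` with `‖DV‖ ≤ K` (`V` itself may be
  unbounded): the v15 stratum «`C² ∩ L^∞ ∩ Ẇ^{1,∞}`» minus its `L^∞` clause.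

WHAT THIS IS NOT: not NS, not E, not rung C1 — `C²` profiles that are neither `o(|y|)` nor uniformly continuous (sparse
spikes of linear-or-faster growth), the weak class (`V ∉ C²`) and all non-self-similar members remain. [folklore;
ChaeShvydkoy2013 §1 (1.3) (the energy growth bound, setting); ConstantinIgnatovaVicol2026Putative §3 (setting)]
-/

noncomputable section

-- flat `Theorems/<Route><Decl>…` files of one crux share the namespace of the crux (tree convention)
set_option linter.dupNamespace false

open MeasureTheory Set Filter Topology Metric Function InnerProductSpace
open scoped RealInnerProductSpace NNReal ENNReal ContDiff

namespace Summit.NavierStokesRegularity.NavierStokesRegularity.Theorems.PowerGaugeEulerLiouville.Loc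

open Literature.Analysis Literature.Analysis.FluidPDE
open Summit.NavierStokesRegularity.NavierStokesRegularity.Theorems.PowerGaugeEulerLiouville.Kelvin

/-! ### The spike estimate: uniform continuity + sub-quadratic `L²`-growth ⇒ sublinear pointwise growth -/

/-- **Spike estimate**: a uniformly continuous field `V` on `ℝ³` with `∫⁻_{B(0,L)} ‖V‖ₑ² ≤ C L^θ` for all `L > 0` (`C < ∞`,
`θ < 2`) has SUBLINEAR growth `V(y) = o(|y|)`: a value `‖V y₀‖ = h ≥ 2` persists as `‖V‖ ≥ h/2` on a ball of fixed radius
`r₀` (the modulus of continuity at `1`), whose contribution `(h/2)² r₀³ |B₁|` to the energy in `B(0, 2‖y₀‖)` is at most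
`C (2‖y₀‖)^θ`; so `h ≲ ‖y₀‖^{θ/2} = o(‖y₀‖)`. [folklore] -/
theorem sublinear_of_uniformContinuous_of_growth {V : EuclideanSpace ℝ (Fin 3) → EuclideanSpace ℝ (Fin 3)}
    (hUC : UniformContinuous V) {C : ℝ≥0∞} (hC : C ≠ ⊤) {θ : ℝ} (hθ : θ < 2)
    (hA : ∀ L : ℝ, 0 < L →
      ∫⁻ y in ball (0 : EuclideanSpace ℝ (Fin 3)) L, ‖V y‖ₑ ^ 2 ≤ C * ENNReal.ofReal (L ^ θ)) :
    ∀ δ : ℝ, 0 < δ → ∃ R : ℝ, ∀ y : EuclideanSpace ℝ (Fin 3), R ≤ ‖y‖ → ‖V y‖ ≤ δ * ‖y‖ := by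
  -- modulus of continuity at `1`
  obtain ⟨r₀, hr₀, hUC1⟩ := Metric.uniformContinuous_iff.1 hUC 1 one_pos
  set v₁ : ℝ≥0∞ := volume (ball (0 : EuclideanSpace ℝ (Fin 3)) 1) with hv₁
  have hv₁pos : 0 < v₁ := measure_ball_pos volume 0 one_pos
  have hv₁top : v₁ ≠ ⊤ := measure_ball_lt_top.ne
  have hv₁r : 0 < v₁.toReal := ENNReal.toReal_pos hv₁pos.ne' hv₁top
  -- the key estimate: `‖y₀‖ ≥ r₀`, `‖V y₀‖ ≥ 2` ⇒ `(‖V y₀‖/2)² (r₀³ |B₁|) ≤ C (2‖y₀‖)^θ`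
  have key : ∀ y₀ : EuclideanSpace ℝ (Fin 3), r₀ ≤ ‖y₀‖ → 2 ≤ ‖V y₀‖ →
      (‖V y₀‖ / 2) ^ 2 * (r₀ ^ 3 * v₁.toReal) ≤ C.toReal * (2 * ‖y₀‖) ^ θ := by
    intro y₀ hy₀ hh
    have hy₀pos : 0 < ‖y₀‖ := lt_of_lt_of_le hr₀ hy₀
    -- `‖V‖ ≥ ‖V y₀‖/2` on `ball y₀ r₀`
    have hlow : ∀ z ∈ ball y₀ r₀, ENNReal.ofReal ((‖V y₀‖ / 2) ^ 2) ≤ ‖V z‖ₑ ^ 2 := by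
      intro z hz
      have hd : dist (V z) (V y₀) < 1 := hUC1 (mem_ball.1 hz)
      rw [dist_eq_norm] at hd
      have h1 : ‖V y₀‖ / 2 ≤ ‖V z‖ := by
        have := norm_sub_norm_le (V y₀) (V z)
        rw [← norm_neg (V y₀ - V z), neg_sub] at this
        linarith
      rw [← ofReal_norm, ← ENNReal.ofReal_pow (norm_nonneg _)]
      exact ENNReal.ofReal_le_ofReal (pow_le_pow_left₀ (by positivity) h1 2)
    have h1 : ENNReal.ofReal ((‖V y₀‖ / 2) ^ 2) * volume (ball y₀ r₀) ≤
        ∫⁻ z in ball y₀ r₀, ‖V z‖ₑ ^ 2 := by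
      rw [← setLIntegral_const]
      exact setLIntegral_mono' measurableSet_ball hlow
    have hsub : ball y₀ r₀ ⊆ ball (0 : EuclideanSpace ℝ (Fin 3)) (2 * ‖y₀‖) := by
      intro z hz
      rw [mem_ball, dist_zero_right]
      rw [mem_ball, dist_eq_norm] at hz
      have := norm_le_norm_add_norm_sub' z y₀
      linarith
    have h2 : ∫⁻ z in ball y₀ r₀, ‖V z‖ₑ ^ 2 ≤ ∫⁻ z in ball (0 : EuclideanSpace ℝ (Fin 3)) (2 * ‖y₀‖), ‖V z‖ₑ ^ 2 :=
      lintegral_mono_set hsub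
    have h3 := hA (2 * ‖y₀‖) (by positivity)
    have h := (h1.trans h2).trans h3
    rw [Measure.addHaar_ball_of_pos volume y₀ hr₀, finrank_euclideanSpace_fin] at h
    have hfin : C * ENNReal.ofReal ((2 * ‖y₀‖) ^ θ) ≠ ⊤ := ENNReal.mul_ne_top hC ENNReal.ofReal_ne_top
    have h' := ENNReal.toReal_mono hfin h
    rw [ENNReal.toReal_mul, ENNReal.toReal_mul, ENNReal.toReal_mul, ENNReal.toReal_ofReal (by positivity),
      ENNReal.toReal_ofReal (by positivity), ENNReal.toReal_ofReal (Real.rpow_nonneg (by positivity) θ)] at h'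
    exact h'
  -- assembly
  intro δ hδ
  set M : ℝ := 4 * C.toReal * (2 : ℝ) ^ θ / (r₀ ^ 3 * v₁.toReal) with hM
  have hden : 0 < r₀ ^ 3 * v₁.toReal := by positivity
  have hM0 : 0 ≤ M := by rw [hM]; positivity
  have h2θ : 0 < 2 - θ := by linarith
  set x₀ : ℝ := (M / δ ^ 2) ^ (2 - θ)⁻¹ with hx₀
  have hx₀0 : 0 ≤ x₀ := Real.rpow_nonneg (by positivity) _
  refine ⟨max (max r₀ 1) (max (2 / δ) x₀), fun y hy => ?_⟩
  have hyr : r₀ ≤ ‖y‖ := (le_max_left _ _).trans ((le_max_left _ _).trans hy)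
  have hy1 : 1 ≤ ‖y‖ := (le_max_right _ _).trans ((le_max_left _ _).trans hy)
  have hy2 : 2 / δ ≤ ‖y‖ := (le_max_left _ _).trans ((le_max_right _ _).trans hy)
  have hyx : x₀ ≤ ‖y‖ := (le_max_right _ _).trans ((le_max_right _ _).trans hy)
  have hypos : 0 < ‖y‖ := lt_of_lt_of_le one_pos hy1
  by_cases hh : ‖V y‖ < 2
  · -- small values: `‖V y‖ < 2 ≤ δ‖y‖`
    have : 2 ≤ δ * ‖y‖ := by rwa [div_le_iff₀' hδ] at hy2
    linarith
  · push Not at hh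
    have hk := key y hyr hh
    -- `‖V y‖² ≤ M ‖y‖^θ`
    have hsq : ‖V y‖ ^ 2 ≤ M * ‖y‖ ^ θ := by
      rw [Real.mul_rpow (by norm_num) (norm_nonneg _)] at hk
      rw [hM]
      rw [div_mul_eq_mul_div, le_div_iff₀ hden]
      nlinarith [hk]
    -- `M ‖y‖^θ ≤ δ² ‖y‖²` since `‖y‖^{2−θ} ≥ x₀^{2−θ} = M/δ²`
    have hpow : M / δ ^ 2 ≤ ‖y‖ ^ (2 - θ) := by
      have h1 : x₀ ^ (2 - θ) ≤ ‖y‖ ^ (2 - θ) := Real.rpow_le_rpow hx₀0 hyx h2θ.le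
      have h2 : x₀ ^ (2 - θ) = M / δ ^ 2 := by
        rw [hx₀, Real.rpow_inv_rpow (by positivity) h2θ.ne']
      rwa [h2] at h1
    have hsplit : ‖y‖ ^ (2 : ℝ) = ‖y‖ ^ θ * ‖y‖ ^ (2 - θ) := by
      rw [← Real.rpow_add hypos]; ring_nf
    have hθpos : 0 < ‖y‖ ^ θ := Real.rpow_pos_of_pos hypos θ
    have hbound : M * ‖y‖ ^ θ ≤ δ ^ 2 * ‖y‖ ^ 2 := by
      have h1 : M ≤ δ ^ 2 * ‖y‖ ^ (2 - θ) := by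
        rw [div_le_iff₀' (by positivity)] at hpow; exact hpow
      calc M * ‖y‖ ^ θ ≤ δ ^ 2 * ‖y‖ ^ (2 - θ) * ‖y‖ ^ θ := mul_le_mul_of_nonneg_right h1 hθpos.le
        _ = δ ^ 2 * (‖y‖ ^ θ * ‖y‖ ^ (2 - θ)) := by ring
        _ = δ ^ 2 * ‖y‖ ^ 2 := by rw [← hsplit, Real.rpow_two]
    have hfin : ‖V y‖ ^ 2 ≤ (δ * ‖y‖) ^ 2 := by
      calc ‖V y‖ ^ 2 ≤ M * ‖y‖ ^ θ := hsq
        _ ≤ δ ^ 2 * ‖y‖ ^ 2 := hbound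
        _ = (δ * ‖y‖) ^ 2 := by ring
    exact (pow_le_pow_iff_left₀ (norm_nonneg _) (by positivity) two_ne_zero).1 hfin

/-! ### Member level: uniformly continuous `C²` profiles, and `C²` profiles with bounded gradient -/

/-- **THE STRATUM «V ∈ C² ∩ UC» OF `stub_selfSimilarExtremalRest`, MEMBER LEVEL.**  Crux hypotheses verbatim, the window
`0 < ρ ≤ ½`, exact self-similarity with profile `(V, P)`: if `V ∈ C²` is UNIFORMLY CONTINUOUS (bounded or not), then
`u = 0` a.e. on `(−∞,0) × ℝ³` — the `A`-gauge growth `∫_{B_L}‖V‖² ≤ c L^{1−2ρ}` and the spike estimate make `V(y) = o(|y|)`,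
and the sublinear rigidity theorem applies. [folklore] -/
theorem selfSimilar_ae_eq_zero_of_uniformContinuousC2_profile {ρ : ℝ} (hρ : 0 < ρ) (hρ1 : ρ ≤ 1 / 2)
    {u : ℝ → EuclideanSpace ℝ (Fin 3) → EuclideanSpace ℝ (Fin 3)} {p : ℝ → EuclideanSpace ℝ (Fin 3) → ℝ}
    {H : ℝ → EuclideanSpace ℝ (Fin 3) → EuclideanSpace ℝ (Fin 3) →L[ℝ] EuclideanSpace ℝ (Fin 3)} {c : ℝ≥0}
    (hsw : IsSuitableWeakSolutionOn (slab (EuclideanSpace ℝ (Fin 3)) (Iio 0) isOpen_Iio) 0 0 u p)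
    (hgauge : ∀ a : ℝ, 0 < a →
      ENNReal.ofReal (a ^ (2 * ρ)) * cknA a (0 : ℝ × EuclideanSpace ℝ (Fin 3)) u +
          ENNReal.ofReal (a ^ ρ) * cknE a (0 : ℝ × EuclideanSpace ℝ (Fin 3)) H +
        ENNReal.ofReal (a ^ (2 * ρ)) * cknD a (0 : ℝ × EuclideanSpace ℝ (Fin 3)) p ≤ (c : ℝ≥0∞))
    {V : EuclideanSpace ℝ (Fin 3) → EuclideanSpace ℝ (Fin 3)} {P : EuclideanSpace ℝ (Fin 3) → ℝ}
    (hu : ∀ τ : ℝ, τ < 0 → u τ = selfSimilarCollapse (1 / (2 + ρ)) 0 V τ)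
    (hp : ∀ τ : ℝ, τ < 0 → p τ = selfSimilarCollapsePressure (1 / (2 + ρ)) 0 P τ)
    (hV : ContDiff ℝ 2 V) (hUC : UniformContinuous V) :
    uncurry u =ᵐ[volume.restrict (Iio (0 : ℝ) ×ˢ (univ : Set (EuclideanSpace ℝ (Fin 3))))] 0 := by
  have hA : ∀ a : ℝ, 0 < a → ENNReal.ofReal (a ^ (2 * ρ)) *
      cknA a (0 : ℝ × EuclideanSpace ℝ (Fin 3)) u ≤ (c : ℝ≥0∞) :=
    fun a ha => le_trans (le_trans le_self_add le_self_add) (hgauge a ha)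
  have hgrowth := profile_energy_growth_of_gaugeA hρ hu hA
  have hsub := sublinear_of_uniformContinuous_of_growth hUC ENNReal.coe_ne_top (θ := 1 - 2 * ρ) (by linarith) hgrowth
  exact selfSimilar_ae_eq_zero_of_sublinearC2_profile hρ (by linarith) hsw hgauge hu hp hV hsub

/-- **THE STRATUM «V ∈ C² ∩ Ẇ^{1,∞}» (velocity possibly UNBOUNDED), MEMBER LEVEL**: crux hypotheses verbatim, the window
`0 < ρ ≤ ½`, exact self-similarity, `V ∈ C²` with `‖DV‖ ≤ K` ⇒ `u = 0` a.e. (a field with bounded gradient is Lipschitz,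
hence uniformly continuous).  This is the v15 stratum «`C² ∩ L^∞ ∩ Ẇ^{1,∞}`» with its `L^∞` clause REMOVED. [folklore] -/
theorem selfSimilar_ae_eq_zero_of_boundedGradientC2_profile {ρ : ℝ} (hρ : 0 < ρ) (hρ1 : ρ ≤ 1 / 2)
    {u : ℝ → EuclideanSpace ℝ (Fin 3) → EuclideanSpace ℝ (Fin 3)} {p : ℝ → EuclideanSpace ℝ (Fin 3) → ℝ}
    {H : ℝ → EuclideanSpace ℝ (Fin 3) → EuclideanSpace ℝ (Fin 3) →L[ℝ] EuclideanSpace ℝ (Fin 3)} {c : ℝ≥0}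
    (hsw : IsSuitableWeakSolutionOn (slab (EuclideanSpace ℝ (Fin 3)) (Iio 0) isOpen_Iio) 0 0 u p)
    (hgauge : ∀ a : ℝ, 0 < a →
      ENNReal.ofReal (a ^ (2 * ρ)) * cknA a (0 : ℝ × EuclideanSpace ℝ (Fin 3)) u +
          ENNReal.ofReal (a ^ ρ) * cknE a (0 : ℝ × EuclideanSpace ℝ (Fin 3)) H +
        ENNReal.ofReal (a ^ (2 * ρ)) * cknD a (0 : ℝ × EuclideanSpace ℝ (Fin 3)) p ≤ (c : ℝ≥0∞))
    {V : EuclideanSpace ℝ (Fin 3) → EuclideanSpace ℝ (Fin 3)} {P : EuclideanSpace ℝ (Fin 3) → ℝ}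
    (hu : ∀ τ : ℝ, τ < 0 → u τ = selfSimilarCollapse (1 / (2 + ρ)) 0 V τ)
    (hp : ∀ τ : ℝ, τ < 0 → p τ = selfSimilarCollapsePressure (1 / (2 + ρ)) 0 P τ)
    (hV : ContDiff ℝ 2 V) {K : ℝ} (hK : ∀ y, ‖fderiv ℝ V y‖ ≤ K) :
    uncurry u =ᵐ[volume.restrict (Iio (0 : ℝ) ×ˢ (univ : Set (EuclideanSpace ℝ (Fin 3))))] 0 := by
  have hK0 : 0 ≤ K := (norm_nonneg _).trans (hK 0)
  have hlip : LipschitzWith ⟨K, hK0⟩ V :=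
    lipschitzWith_of_nnnorm_fderiv_le (hV.differentiable (by norm_num)) fun x => by
      rw [← NNReal.coe_le_coe, coe_nnnorm]; exact hK x
  exact selfSimilar_ae_eq_zero_of_uniformContinuousC2_profile hρ hρ1 hsw hgauge hu hp hV hlip.uniformContinuous

end Summit.NavierStokesRegularity.NavierStokesRegularity.Theorems.PowerGaugeEulerLiouville.Loc

end
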